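import Mathlib.Analysis.SpecialFunctions.Integrals.Basic
import Mathlib.MeasureTheory.Integral.IntervalIntegral.FundThmCalculus
import Literature.NumberTheory.Sieve.BuchstabFunction
import HarnessLib

/-!
# Cell densities `I_j(u)` of rough integers (Buchstab–Dickman–Alladi)

Topic `Literature/NumberTheory/Sieve`, next to `BuchstabFunction.lean`.

For `u ≥ 1` let `Φ(x, x^{1/u}) = #{n ≤ x : P⁻(n) > x^{1/u}}` count the `x^{1/u}`-rough integers; by
Buchstab, `Φ(x, x^{1/u}) ∼ u ω(u) · x/log x` (`buchstabOmega`, Montgomery–Vaughan Thm 7.11). Sorting the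
rough integers by their number of prime factors `Ω(n) = j` splits the main term: the *cell densities*
are the functions `I_j : ℝ → ℝ`, `j ∈ ℕ`, defined by BUCHSTAB'S ITERATION
`I_0 = 0`, `I_1(u) = 1` (`u ≥ 1`; `0` for `u < 1`), `I_{j+2}(u) = ∫_1^{u-1} I_{j+1}(t) dt/t`,
so that `I_2(u) = log (u − 1)` (`u ≥ 2`), `I_3(u) = ∫_3^u log(v − 2) dv/(v − 1)` (`u ≥ 3`), …; these are
literally the successive terms of `u ω(u) = 1 + log(u − 1) + ∫_3^u log(v − 2)/(v − 1) dv + ⋯`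
(Montgomery–Vaughan, *Multiplicative Number Theory I*, §7.2: (7.39) `u w(u) = ∫_1^{u−1} w(v) dv + 1`,
the Buchstab identity (7.43) `Φ(x, y) = 1 + Σ_{y ≤ p ≤ x} Φ(x/p, p)`, and Exercise 7.2.1.2 (a)–(c), which
prints the first four terms). The `j`-th term is the density of the cell `Ω(n) = j`:
heuristically (and by Alladi's theorem, K. Alladi, *The distribution of ν(n) in the sieve of
Eratosthenes*, Quart. J. Math. Oxford (2) 33 (1982) 129–148; see also Tenenbaum, *Introduction to
analytic and probabilistic number theory*, III.6) `#{n ≤ x : P⁻(n) > x^{1/u}, Ω(n) = j} ∼ I_j(u) x/log x`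
for fixed `u` and `1 ≤ j < u`: conditioning on the least prime factor `p = x^{1/t}` of `n = p m` leaves
`m ≤ x/p` rough at level `p = (x/p)^{1/(t-1)}` with `Ω(m) = j − 1`, and `Σ_p (x/p)/log(x/p) · I_{j−1}(t − 1)`
becomes `(x/log x) ∫ I_{j−1}(t − 1) dt/(t − 1)` after `dy/(y log y) = −dt/t`. The asymptotic statement
itself is NOT vendored here (no named fact); this file is the DEFINITION and its elementary calculus.

## Main definitions and results (all proved)

* `roughCellDensity j u = I_j(u)` (structural recursion on `j`, verbatim the recursion used by the
  `Parity/GeneralizedHardyLittlewood` crux lines, so that their local `cellDensity` is provably — per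
  constructor definitionally — equal to it: `roughCellDensity_zero/one/succ_succ`).
* `roughCellDensity_of_le` (D1): `I_j(u) = 0` for `u ≤ j`, `j ≥ 2`; `roughCellDensity_of_lt`: `I_j(u) = 0`
  for `u < j`.
* `roughCellDensity_pos` (D2): `0 < I_j(u)` for `u > j`, `j ≥ 1`; `roughCellDensity_nonneg`.
* `continuous_roughCellDensity` (D3): `I_j` is continuous for `j ≥ 2`
  (`roughCellDensity_two_eq_log_max`: `I_2(u) = log (max (u − 1) 1)`).
* `hasDerivAt_roughCellDensity_succ` (D4): `I_{j+1}'(u) = I_j(u − 1)/(u − 1)` for `u > 2`, `j ≥ 1`.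
* `monotone_roughCellDensity` (D5): each `I_j` is nondecreasing.
* `roughCellDensity_succ_succ_eq_integral_sub`: the shifted form `I_{j+2}(u) = ∫_2^u I_{j+1}(v−1) dv/(v−1)`.
* `sum_roughCellDensity_eq_mul_buchstabOmega` (Buchstab): `Σ_{1 ≤ j ≤ N+1} I_j(u) = u ω(u)` for
  `1 ≤ u ≤ N + 2` — the cells exhaust the rough integers; whence `roughCellDensity_le`: `I_j(u) ≤ u`.

## References

* H. L. Montgomery, R. C. Vaughan, *Multiplicative Number Theory I. Classical Theory*, CUP (2007), §7.2,
  (7.37)–(7.39), (7.43), Exercise 7.2.1.2. [MontgomeryVaughan2007]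
* K. Alladi, *The distribution of ν(n) in the sieve of Eratosthenes*, Quart. J. Math. Oxford (2) 33
  (1982) 129–148. [Alladi1982]
* G. Tenenbaum, *Introduction to analytic and probabilistic number theory*, 3rd ed., AMS (2015), III.6.
  [Tenenbaum2015]
-/

open Set Filter MeasureTheory intervalIntegral
open scoped Topology

noncomputable section

namespace Literature.NumberTheory.Sieve

/-- **Cell densities of rough integers** `I_j(u) = roughCellDensity j u`: Buchstab's iteration
`I_0 = 0`, `I_1(u) = 1` for `u ≥ 1` and `0` for `u < 1`, `I_{j+2}(u) = ∫_1^{u−1} I_{j+1}(t) dt/t`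
(an interval integral: for `u < 2` the orientation is reversed but the integrand vanishes on
`(u − 1, 1)`, so `I_{j+2}(u) = 0`). `I_j(u)` is the density, in units of `x/log x`, of the integers
`n ≤ x` with least prime factor `> x^{1/u}` and `Ω(n) = j`; `Σ_j I_j(u) = u ω(u)` is the term-by-term
expansion of Buchstab's `u w(u) = 1 + ∫_1^{u−1} w(v) dv` (Montgomery–Vaughan (7.39); Exercise 7.2.1.2
prints `I_1 + I_2 + I_3 + I_4 = 1 + log(u−1) + ∫_3^u log(v−2)/(v−1) dv + ∫_4^u log((u−1)/(v−1)) log(v−3)/(v−2) dv`).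
[cite: MontgomeryVaughan2007, §7.2 (7.39) (7.43) and Exercise 7.2.1.2] -/
def roughCellDensity : ℕ → ℝ → ℝ
  | 0, _ => 0
  | 1, u => if 1 ≤ u then 1 else 0
  | j + 2, u => ∫ t in (1 : ℝ)..(u - 1), roughCellDensity (j + 1) t / t

variable {j : ℕ} {u : ℝ}

/-! ### Unfolding lemmas -/

/-- `I_0 = 0`. [folklore] -/
@[simp] theorem roughCellDensity_zero (u : ℝ) : roughCellDensity 0 u = 0 := rfl

/-- `I_1(u) = [1 ≤ u]`. [folklore] -/
theorem roughCellDensity_one (u : ℝ) : roughCellDensity 1 u = if 1 ≤ u then 1 else 0 := rfl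

/-- `I_{j+2}(u) = ∫_1^{u−1} I_{j+1}(t) dt/t`. [folklore] -/
theorem roughCellDensity_succ_succ (j : ℕ) (u : ℝ) :
    roughCellDensity (j + 2) u = ∫ t in (1 : ℝ)..(u - 1), roughCellDensity (j + 1) t / t := rfl

/-- `I_{j+1}(u) = ∫_1^{u−1} I_j(t) dt/t` for `j ≥ 1`. [folklore] -/
theorem roughCellDensity_succ (hj : 1 ≤ j) (u : ℝ) :
    roughCellDensity (j + 1) u = ∫ t in (1 : ℝ)..(u - 1), roughCellDensity j t / t := by
  obtain ⟨k, rfl⟩ : ∃ k, j = k + 1 := ⟨j - 1, by omega⟩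
  rfl

/-- `I_1(u) = 1` for `u ≥ 1`. [folklore] -/
theorem roughCellDensity_one_of_one_le (hu : 1 ≤ u) : roughCellDensity 1 u = 1 := if_pos hu

/-- `I_1(u) = 0` for `u < 1`. [folklore] -/
theorem roughCellDensity_one_of_lt_one (hu : u < 1) : roughCellDensity 1 u = 0 :=
  if_neg (not_le.mpr hu)

/-- `I_{j+2}(u) = ∫_2^u I_{j+1}(v − 1) dv/(v − 1)`: the same recursion written with the substitution
`t = v − 1` (the form `∂_u I_{j+2}(u) = I_{j+1}(u − 1)/(u − 1)` integrates to). [folklore] -/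
theorem roughCellDensity_succ_succ_eq_integral_sub (j : ℕ) (u : ℝ) :
    roughCellDensity (j + 2) u = ∫ v in (2 : ℝ)..u, roughCellDensity (j + 1) (v - 1) / (v - 1) := by
  have h := intervalIntegral.integral_comp_sub_right
    (fun t : ℝ => roughCellDensity (j + 1) t / t) (a := 2) (b := u) 1
  rw [roughCellDensity_succ_succ, h]
  norm_num

/-! ### Vanishing below the index and nonnegativity -/

/-- An interval integral of a function vanishing on the open interval between the endpoints is zero
(whatever the orientation). [folklore] -/
theorem intervalIntegral_eq_zero_of_forall_mem_Ioo {f : ℝ → ℝ} {a b : ℝ}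
    (h : ∀ t ∈ Ioo (min a b) (max a b), f t = 0) : ∫ t in a..b, f t = 0 := by
  rcases le_total a b with hab | hab
  · rw [min_eq_left hab, max_eq_right hab] at h
    rw [intervalIntegral.integral_of_le hab, integral_Ioc_eq_integral_Ioo]
    exact setIntegral_eq_zero_of_forall_eq_zero h
  · rw [min_eq_right hab, max_eq_left hab] at h
    rw [intervalIntegral.integral_symm, intervalIntegral.integral_of_le hab,
      integral_Ioc_eq_integral_Ioo, setIntegral_eq_zero_of_forall_eq_zero h, neg_zero]

/-- `I_j(u) = 0` for `u < j` (every `j`). [folklore] -/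
theorem roughCellDensity_of_lt : ∀ (j : ℕ) {u : ℝ}, u < j → roughCellDensity j u = 0
  | 0, _, _ => rfl
  | 1, _, hu => roughCellDensity_one_of_lt_one (by simpa using hu)
  | j + 2, u, hu => by
    rw [roughCellDensity_succ_succ]
    refine intervalIntegral_eq_zero_of_forall_mem_Ioo fun t ht => ?_
    have hj0 : (0 : ℝ) ≤ j := Nat.cast_nonneg j
    have hu' : u - 1 ≤ (j : ℝ) + 1 := by push_cast at hu; linarith
    have ht' : t < (j : ℝ) + 1 := lt_of_lt_of_le ht.2 (max_le (by linarith) hu')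
    rw [roughCellDensity_of_lt (j + 1) (by push_cast; exact ht'), zero_div]

/-- **(D1)** `I_j(u) = 0` for `u ≤ j` when `j ≥ 2` (the integrand `I_{j−1}(t)/t` vanishes for
`t < j − 1`, i.e. on the whole open interval of integration). [folklore] -/
theorem roughCellDensity_of_le (hj : 2 ≤ j) (hu : u ≤ j) : roughCellDensity j u = 0 := by
  obtain ⟨k, rfl⟩ : ∃ k, j = k + 2 := ⟨j - 2, by omega⟩
  rw [roughCellDensity_succ_succ]
  refine intervalIntegral_eq_zero_of_forall_mem_Ioo fun t ht => ?_
  have hk0 : (0 : ℝ) ≤ k := Nat.cast_nonneg k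
  have hu' : u - 1 ≤ (k : ℝ) + 1 := by push_cast at hu; linarith
  have ht' : t < (k : ℝ) + 1 := lt_of_lt_of_le ht.2 (max_le (by linarith) hu')
  rw [roughCellDensity_of_lt (k + 1) (by push_cast; exact ht'), zero_div]

/-- `I_j(u) = 0` for `u < 1` (every `j`). [folklore] -/
theorem roughCellDensity_of_lt_one (j : ℕ) (hu : u < 1) : roughCellDensity j u = 0 := by
  rcases Nat.eq_zero_or_pos j with rfl | hj
  · rfl
  · exact roughCellDensity_of_lt j (lt_of_lt_of_le hu (by exact_mod_cast hj))

/-- `0 ≤ I_j(u)` for all `j`, `u`. [folklore] -/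
theorem roughCellDensity_nonneg : ∀ (j : ℕ) (u : ℝ), 0 ≤ roughCellDensity j u
  | 0, _ => le_rfl
  | 1, u => by
    rw [roughCellDensity_one]
    split_ifs <;> norm_num
  | j + 2, u => by
    rcases le_or_gt u ((j : ℝ) + 2) with hu | hu
    · exact (roughCellDensity_of_le (j := j + 2) (by omega) (by push_cast; exact hu)).ge
    · have hj0 : (0 : ℝ) ≤ j := Nat.cast_nonneg j
      rw [roughCellDensity_succ_succ]
      exact intervalIntegral.integral_nonneg (by linarith) fun t ht =>
        div_nonneg (roughCellDensity_nonneg (j + 1) t) (by linarith [ht.1])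

/-! ### The second cell: `I_2(u) = log (u − 1)` -/

/-- **`I_2(u) = log (u − 1)` for `u ≥ 2`** (`= ∫_1^{u−1} dt/t`; Montgomery–Vaughan Exercise 7.2.1.2 (a):
`w(u) = (1 + log(u − 1))/u` on `[2, 3]`). [cite: MontgomeryVaughan2007, Exercise 7.2.1.2 (a)] -/
theorem roughCellDensity_two_of_two_le (hu : 2 ≤ u) : roughCellDensity 2 u = Real.log (u - 1) := by
  rw [show roughCellDensity 2 u = ∫ t in (1 : ℝ)..(u - 1), roughCellDensity 1 t / t from rfl]
  have h : ∫ t in (1 : ℝ)..(u - 1), roughCellDensity 1 t / t = ∫ t in (1 : ℝ)..(u - 1), t⁻¹ := by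
    refine intervalIntegral.integral_congr fun t ht => ?_
    rw [uIcc_of_le (by linarith)] at ht
    show roughCellDensity 1 t / t = t⁻¹
    rw [roughCellDensity_one_of_one_le ht.1, one_div]
  rw [h, integral_inv_of_pos one_pos (by linarith), div_one]

/-- `I_2(u) = log (max (u − 1) 1)` for every `u` (a closed form exhibiting continuity). [folklore] -/
theorem roughCellDensity_two_eq_log_max (u : ℝ) :
    roughCellDensity 2 u = Real.log (max (u - 1) 1) := by
  rcases le_or_gt u 2 with hu | hu
  · rw [roughCellDensity_of_le le_rfl (by exact_mod_cast hu), max_eq_right (by linarith),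
      Real.log_one]
  · rw [roughCellDensity_two_of_two_le hu.le, max_eq_left (by linarith)]

/-- `I_2` is continuous. [folklore] -/
theorem continuous_roughCellDensity_two : Continuous (roughCellDensity 2) := by
  have h : Continuous fun u : ℝ => Real.log (max (u - 1) 1) :=
    ((continuous_id.sub continuous_const).max continuous_const).log fun u =>
      ne_of_gt (lt_of_lt_of_le one_pos (le_max_right _ _))
  exact h.congr fun u => (roughCellDensity_two_eq_log_max u).symm

/-! ### Differentiability and continuity -/

/-- `t ↦ I_1(t)/t = 1/t` is continuous on `[1, ∞)`. [folklore] -/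
theorem continuousOn_roughCellDensity_one_div :
    ContinuousOn (fun t : ℝ => roughCellDensity 1 t / t) (Ici 1) := by
  refine (continuousOn_inv₀.mono ?_).congr fun t (ht : 1 ≤ t) => ?_
  · exact fun t (ht : 1 ≤ t) => show t ≠ 0 from ne_of_gt (lt_of_lt_of_le one_pos ht)
  · show roughCellDensity 1 t / t = t⁻¹
    rw [roughCellDensity_one_of_one_le ht, one_div]

/-- If `I_j` is continuous then `t ↦ I_j(t)/t` is continuous on `[1, ∞)`. [folklore] -/
theorem continuousOn_roughCellDensity_div_of_continuous (hc : Continuous (roughCellDensity j)) :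
    ContinuousOn (fun t : ℝ => roughCellDensity j t / t) (Ici 1) :=
  hc.continuousOn.div continuousOn_id fun _ ht => ne_of_gt (lt_of_lt_of_le one_pos ht)

/-- FTC step: if `t ↦ I_j(t)/t` is continuous on `[1, ∞)` (`j ≥ 1`) then
`I_{j+1}'(u) = I_j(u − 1)/(u − 1)` at every `u > 2`. [folklore] -/
theorem hasDerivAt_roughCellDensity_succ_of_continuousOn (hj : 1 ≤ j)
    (hg : ContinuousOn (fun t : ℝ => roughCellDensity j t / t) (Ici 1)) (hu : 2 < u) :
    HasDerivAt (roughCellDensity (j + 1)) (roughCellDensity j (u - 1) / (u - 1)) u := by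
  have hu1 : 1 < u - 1 := by linarith
  have hint : IntervalIntegrable (fun t : ℝ => roughCellDensity j t / t) volume 1 (u - 1) := by
    refine (hg.mono fun t ht => ?_).intervalIntegrable
    rw [uIcc_of_le hu1.le] at ht
    exact ht.1
  have h1 : HasDerivAt (fun w => ∫ t in (1 : ℝ)..w, roughCellDensity j t / t)
      (roughCellDensity j (u - 1) / (u - 1)) (u - 1) :=
    intervalIntegral.integral_hasDerivAt_right hint
      ((hg.mono Ioi_subset_Ici_self).stronglyMeasurableAtFilter isOpen_Ioi _ hu1)
      (hg.continuousAt (Ici_mem_nhds hu1))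
  have h2 := h1.comp u ((hasDerivAt_id' u).sub_const 1)
  rw [mul_one] at h2
  refine h2.congr_of_eventuallyEq (Eventually.of_forall fun x => ?_)
  exact roughCellDensity_succ hj x

/-- **(D3)** `I_j` is continuous for every `j ≥ 2` (`I_1` jumps at `u = 1`). Induction: `I_2` by its
closed form; if `I_j` is continuous (`j ≥ 2`) then `I_{j+1}` is differentiable at every `u > 2` and
identically `0` on `(−∞, 3) ⊆ (−∞, j + 1]`. [folklore] -/
theorem continuous_roughCellDensity (hj : 2 ≤ j) : Continuous (roughCellDensity j) := by
  induction j, hj using Nat.le_induction with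
  | base => exact continuous_roughCellDensity_two
  | succ j hj ih =>
    have hg := continuousOn_roughCellDensity_div_of_continuous ih
    have hj2 : (2 : ℝ) ≤ j := by exact_mod_cast hj
    refine continuous_iff_continuousAt.2 fun u => ?_
    rcases lt_or_ge 2 u with hu | hu
    · exact (hasDerivAt_roughCellDensity_succ_of_continuousOn (by omega) hg hu).continuousAt
    · have hev : roughCellDensity (j + 1) =ᶠ[𝓝 u] fun _ => 0 := by
        filter_upwards [Iio_mem_nhds (show u < 3 by linarith)] with t ht
        have ht3 : t < 3 := ht
        exact roughCellDensity_of_le (by omega) (by push_cast; linarith)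
      exact (continuousAt_congr hev).2 continuousAt_const

/-- `I_j` is continuous on `[1, ∞)` for every `j ≥ 1`. [folklore] -/
theorem continuousOn_roughCellDensity (hj : 1 ≤ j) : ContinuousOn (roughCellDensity j) (Ici 1) := by
  rcases eq_or_lt_of_le hj with rfl | hj'
  · exact continuousOn_const.congr fun t (ht : 1 ≤ t) => roughCellDensity_one_of_one_le ht
  · exact (continuous_roughCellDensity hj').continuousOn

/-- `t ↦ I_j(t)/t` is continuous on `[1, ∞)` for every `j ≥ 1`. [folklore] -/
theorem continuousOn_roughCellDensity_div (hj : 1 ≤ j) :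
    ContinuousOn (fun t : ℝ => roughCellDensity j t / t) (Ici 1) := by
  rcases eq_or_lt_of_le hj with rfl | hj'
  · exact continuousOn_roughCellDensity_one_div
  · exact continuousOn_roughCellDensity_div_of_continuous (continuous_roughCellDensity hj')

/-- `t ↦ I_j(t)/t` is interval integrable on every `[a, b]` with `a, b ≥ 1` (`j ≥ 1`). [folklore] -/
theorem intervalIntegrable_roughCellDensity_div (hj : 1 ≤ j) {a b : ℝ} (ha : 1 ≤ a) (hb : 1 ≤ b) :
    IntervalIntegrable (fun t : ℝ => roughCellDensity j t / t) volume a b := by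
  refine ((continuousOn_roughCellDensity_div hj).mono fun t ht => ?_).intervalIntegrable
  rw [mem_uIcc] at ht
  rcases ht with ht | ht
  · exact ha.trans ht.1
  · exact hb.trans ht.1

/-- **(D4)** `I_{j+1}'(u) = I_j(u − 1)/(u − 1)` for `u > 2` and `j ≥ 1` (fundamental theorem of calculus
at the upper limit `u − 1 > 1`, where the integrand is continuous). [folklore] -/
theorem hasDerivAt_roughCellDensity_succ (hj : 1 ≤ j) (hu : 2 < u) :
    HasDerivAt (roughCellDensity (j + 1)) (roughCellDensity j (u - 1) / (u - 1)) u :=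
  hasDerivAt_roughCellDensity_succ_of_continuousOn hj (continuousOn_roughCellDensity_div hj) hu

/-- `I_j` is continuous at every `u > 1`, for every `j`. [folklore] -/
theorem continuousAt_roughCellDensity (j : ℕ) (hu : 1 < u) : ContinuousAt (roughCellDensity j) u := by
  rcases Nat.eq_zero_or_pos j with rfl | hj
  · exact continuousAt_const
  · exact (continuousOn_roughCellDensity hj).continuousAt (Ici_mem_nhds hu)

/-! ### Positivity and monotonicity -/

/-- **(D2)** `0 < I_j(u)` for `u > j`, `j ≥ 1`: by induction, `I_{j+1}(u) ≥ ∫_j^{u−1} I_j(t) dt/t > 0`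
since the integrand is positive on `(j, u − 1)`. [folklore] -/
theorem roughCellDensity_pos (hj : 1 ≤ j) (hu : (j : ℝ) < u) : 0 < roughCellDensity j u := by
  induction j, hj using Nat.le_induction generalizing u with
  | base =>
    rw [Nat.cast_one] at hu
    rw [roughCellDensity_one_of_one_le hu.le]
    exact one_pos
  | succ j hj ih =>
    push_cast at hu
    have hj1 : (1 : ℝ) ≤ j := by exact_mod_cast hj
    rw [roughCellDensity_succ hj, ← intervalIntegral.integral_add_adjacent_intervals
      (intervalIntegrable_roughCellDensity_div hj (a := 1) (b := (j : ℝ)) le_rfl hj1)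
      (intervalIntegrable_roughCellDensity_div hj (a := (j : ℝ)) (b := u - 1) hj1 (by linarith))]
    refine add_pos_of_nonneg_of_pos ?_ ?_
    · exact intervalIntegral.integral_nonneg hj1 fun t ht =>
        div_nonneg (roughCellDensity_nonneg j t) (by linarith [ht.1])
    · refine intervalIntegral.intervalIntegral_pos_of_pos_on
        (intervalIntegrable_roughCellDensity_div hj (a := (j : ℝ)) (b := u - 1) hj1 (by linarith))
        (fun t ht => ?_) (by linarith)
      exact div_pos (ih ht.1) (by linarith [ht.1])

/-- `0 < I_j(u) ↔ j < u` for `j ≥ 2`. [folklore] -/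
theorem roughCellDensity_pos_iff (hj : 2 ≤ j) : 0 < roughCellDensity j u ↔ (j : ℝ) < u := by
  refine ⟨fun h => ?_, roughCellDensity_pos (le_trans (by norm_num) hj)⟩
  by_contra hle
  rw [roughCellDensity_of_le hj (not_lt.mp hle)] at h
  exact lt_irrefl 0 h

/-- **(D5)** each `I_j` is nondecreasing: `I_j(b) − I_j(a) = ∫_{a−1}^{b−1} I_{j−1}(t) dt/t ≥ 0`.
[folklore] -/
theorem monotone_roughCellDensity : ∀ j : ℕ, Monotone (roughCellDensity j)
  | 0 => fun _ _ _ => le_rfl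
  | 1 => fun a b hab => by
    rw [roughCellDensity_one, roughCellDensity_one]
    split_ifs <;> linarith
  | j + 2 => fun a b hab => by
    rcases le_or_gt a ((j : ℝ) + 2) with ha | ha
    · rw [roughCellDensity_of_le (j := j + 2) (by omega) (by push_cast; exact ha)]
      exact roughCellDensity_nonneg _ _
    · have hj0 : (0 : ℝ) ≤ j := Nat.cast_nonneg j
      have ha1 : 1 ≤ a - 1 := by linarith
      have hI : ∀ c : ℝ, 1 ≤ c →
          IntervalIntegrable (fun t : ℝ => roughCellDensity (j + 1) t / t) volume 1 c :=
        fun c hc => intervalIntegrable_roughCellDensity_div (j := j + 1) (by omega) le_rfl hc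
      rw [← sub_nonneg, roughCellDensity_succ_succ, roughCellDensity_succ_succ,
        intervalIntegral.integral_interval_sub_left (hI _ (by linarith)) (hI _ ha1)]
      exact intervalIntegral.integral_nonneg (by linarith) fun t ht =>
        div_nonneg (roughCellDensity_nonneg _ _) (by linarith [ht.1])

/-! ### Buchstab: the cells exhaust the rough integers, `Σ_j I_j(u) = u ω(u)` -/

/-- The partial sums `S_{N+1}(t) = Σ_{j ≤ N} I_{j+1}(t)` satisfy `S_{N+1}'(u) = S_N(u − 1)/(u − 1)` for
`u > 2` (sum of (D4); `I_1` is locally constant). This is the `ζ = 1` case of the delay ladder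
`∂_t Σ_{j<N+1} I_{j+1}(t) ζ^j = ζ Σ_{j<N} I_{j+1}(t−1) ζ^j/(t−1)`. [folklore] -/
theorem hasDerivAt_sum_roughCellDensity (N : ℕ) (hu : 2 < u) :
    HasDerivAt (fun t => ∑ j ∈ Finset.range (N + 1), roughCellDensity (j + 1) t)
      ((∑ j ∈ Finset.range N, roughCellDensity (j + 1) (u - 1)) / (u - 1)) u := by
  have h1 : HasDerivAt (roughCellDensity 1) 0 u := by
    refine (hasDerivAt_const u (1 : ℝ)).congr_of_eventuallyEq ?_
    filter_upwards [Ioi_mem_nhds (show (1 : ℝ) < u by linarith)] with t ht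
    exact roughCellDensity_one_of_one_le (le_of_lt ht)
  have h2 : HasDerivAt (fun t => ∑ j ∈ Finset.range N, roughCellDensity (j + 1 + 1) t)
      (∑ j ∈ Finset.range N, roughCellDensity (j + 1) (u - 1) / (u - 1)) u :=
    HasDerivAt.fun_sum fun j _ => hasDerivAt_roughCellDensity_succ (j := j + 1) (by omega) hu
  have h3 := h2.add h1
  rw [← Finset.sum_div, add_zero] at h3
  refine h3.congr_of_eventuallyEq (Eventually.of_forall fun t => ?_)
  exact Finset.sum_range_succ' (fun j => roughCellDensity (j + 1) t) N

/-- The partial sums `Σ_{j<N} I_{j+1}` are continuous on `[1, ∞)`. [folklore] -/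
theorem continuousOn_sum_roughCellDensity (N : ℕ) :
    ContinuousOn (fun t => ∑ j ∈ Finset.range N, roughCellDensity (j + 1) t) (Ici 1) :=
  continuousOn_finsetSum _ fun _ _ => continuousOn_roughCellDensity (by omega)

/-- **Buchstab's identity for the cells**: `Σ_{1 ≤ j ≤ N+1} I_j(u) = u ω(u)` for `1 ≤ u ≤ N + 2`
(so for `u ≤ N + 2` the sum is the full series, all further cells vanishing). Both sides are `1` on
`[1, 2]`, are continuous, and have the same derivative `ω(u − 1)` for `u > 2`
(`hasDerivAt_sum_roughCellDensity`, induction, and `(u ω(u))' = ω(u − 1)`,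
`hasDerivAt_mul_buchstabOmega`); this is the term-by-term form of Montgomery–Vaughan (7.39)
`u w(u) = ∫_1^{u−1} w(v) dv + 1`. [cite: MontgomeryVaughan2007, §7.2 (7.39) and Exercise 7.2.1.2] -/
theorem sum_roughCellDensity_eq_mul_buchstabOmega :
    ∀ (N : ℕ) {u : ℝ}, 1 ≤ u → u ≤ N + 2 →
      ∑ j ∈ Finset.range (N + 1), roughCellDensity (j + 1) u = u * buchstabOmega u
  | 0, u, h1, h2 => by
    rw [Nat.cast_zero, zero_add] at h2
    rw [Finset.sum_range_one, roughCellDensity_one_of_one_le h1, buchstabOmega_eq_inv h1 h2,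
      mul_inv_cancel₀ (ne_of_gt (lt_of_lt_of_le one_pos h1))]
  | N + 1, u, h1, h2 => by
    -- below `N + 2` the new cell vanishes and the induction hypothesis applies verbatim
    have hle : ∀ v : ℝ, 1 ≤ v → v ≤ N + 2 →
        ∑ j ∈ Finset.range (N + 1 + 1), roughCellDensity (j + 1) v = v * buchstabOmega v := by
      intro v hv1 hv2
      rw [Finset.sum_range_succ, roughCellDensity_of_le (j := N + 1 + 1) (by omega)
        (by push_cast; linarith), add_zero]
      exact sum_roughCellDensity_eq_mul_buchstabOmega N hv1 hv2
    rcases le_or_gt u ((N : ℝ) + 2) with hu | hu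
    · exact hle u h1 hu
    -- on `(N + 2, N + 3]`: same derivative `ω(t − 1)` as `t ω(t)` and the same value at `N + 2`
    push_cast at h2
    have hN : (0 : ℝ) ≤ N := Nat.cast_nonneg N
    set a : ℝ := (N : ℝ) + 2 with ha
    have hau : a ≤ u := hu.le
    have hDa : ∑ j ∈ Finset.range (N + 1 + 1), roughCellDensity (j + 1) a - a * buchstabOmega a = 0 :=
      sub_eq_zero.mpr (hle a (by linarith) le_rfl)
    have hcont : ContinuousOn (fun t => ∑ j ∈ Finset.range (N + 1 + 1), roughCellDensity (j + 1) t
        - t * buchstabOmega t) (Icc a u) :=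
      ((continuousOn_sum_roughCellDensity (N + 1 + 1)).sub continuousOn_mul_buchstabOmega).mono
        fun t ht => show (1 : ℝ) ≤ t by linarith [ht.1]
    have hderiv : ∀ t ∈ Ioo a u, HasDerivAt (fun t => ∑ j ∈ Finset.range (N + 1 + 1),
        roughCellDensity (j + 1) t - t * buchstabOmega t) 0 t := by
      intro t ht
      have ht2 : 2 < t := by linarith [ht.1]
      have hS := hasDerivAt_sum_roughCellDensity (u := t) (N + 1) ht2
      rw [sum_roughCellDensity_eq_mul_buchstabOmega N (by linarith [ht.1]) (by linarith [ht.2]),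
        mul_div_cancel_left₀ _ (ne_of_gt (by linarith) : t - 1 ≠ 0)] at hS
      have h := hS.sub (hasDerivAt_mul_buchstabOmega ht2)
      rwa [sub_self] at h
    have hint := intervalIntegral.integral_eq_sub_of_hasDerivAt_of_le hau hcont hderiv
      intervalIntegrable_const
    rw [intervalIntegral.integral_zero, hDa, sub_zero] at hint
    exact sub_eq_zero.mp hint.symm

/-- `I_j(u) ≤ u ω(u)` for `j ≥ 1`, `u ≥ 1` (one nonnegative cell of the partition). [folklore] -/
theorem roughCellDensity_le_mul_buchstabOmega (hj : 1 ≤ j) (hu : 1 ≤ u) :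
    roughCellDensity j u ≤ u * buchstabOmega u := by
  obtain ⟨k, rfl⟩ : ∃ k, j = k + 1 := ⟨j - 1, by omega⟩
  obtain ⟨N, hN⟩ := exists_nat_ge (max (u - 2) k)
  have hk : k ≤ N := by exact_mod_cast le_trans (le_max_right _ _) hN
  have huN : u ≤ N + 2 := by linarith [le_trans (le_max_left _ _) hN]
  rw [← sum_roughCellDensity_eq_mul_buchstabOmega N hu huN]
  exact Finset.single_le_sum (f := fun j => roughCellDensity (j + 1) u)
    (fun i _ => roughCellDensity_nonneg _ _) (Finset.mem_range.mpr (Nat.lt_succ_of_le hk))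

/-- `I_j(u) ≤ u` for `j ≥ 1` and `u ≥ 1` (since `ω ≤ 1`). [folklore] -/
theorem roughCellDensity_le (hj : 1 ≤ j) (hu : 1 ≤ u) : roughCellDensity j u ≤ u :=
  (roughCellDensity_le_mul_buchstabOmega hj hu).trans
    (mul_le_of_le_one_right (by linarith) (buchstabOmega_le_one u))

end Literature.NumberTheory.Sieve
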